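import Literature.Algebra.Module.SplitSurjectiveBaseChange
import Mathlib.AlgebraicGeometry.Fiber
import Mathlib.AlgebraicGeometry.Morphisms.ClosedImmersion
import Mathlib.RingTheory.Localization.BaseChange
import HarnessLib

/-!
# A finite morphism whose fibre at a point is a closed immersion is a closed immersion near that point (affine core)

Topic `AlgebraicGeometry/Morphisms`; namespace `Literature.AlgebraicGeometry.Morphisms`. THEOREMS ONLY (no definition, no named
fact, no instance, no `sorry`).

Let `R → B` be a FINITE ring map (so `Spec B → Spec R` is a finite morphism) and `𝔭 ∈ Spec R`. If the scheme-theoretic fibre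
`Spec (κ(𝔭) ⊗_R B) → Spec κ(𝔭)` is a closed immersion — i.e. the fibre is empty or the reduced point, equivalently
`κ(𝔭) → κ(𝔭) ⊗_R B` is onto —, then `R_r → B_r = R_r ⊗_R B` is onto for some `r ∉ 𝔭`, i.e. `Spec B → Spec R` is a CLOSED
IMMERSION over the neighbourhood `D(r)` of `𝔭`. This is the affine core of EGA III 4.6.7 (ii) («`f` propre, `g_y` immersion
fermée ⇒ `g` immersion fermée au voisinage de la fibre») and of EGA III 4.7.1 (fibrewise ample ⇒ relatively ample): Nakayama
on the finite `R`-module `coker (R → B)` — the tree's ★ `Literature.Algebra.Module.exists_surjective_baseChange_away` («cohomology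
and base change above the vanishing line», B-p04) applied to the two-term complex `R → B`.

* `surjective_algebraMap_tensor_iff_surjective_baseChange` — for an `R`-algebra `B′`: `B′ → B′ ⊗_R B` is onto iff the base
  change `(R → B) ⊗_R B′` is onto;
* `surjective_of_isClosedImmersion_SpecMap` — a closed immersion `Spec T → Spec K` has `K → T` onto;
* **`exists_surjective_algebraMap_away_tensor_of_fiber`** — the algebraic form: `κ(𝔭) ↠ κ(𝔭) ⊗_R B` ⇒
  `∃ r ∉ 𝔭, R_r ↠ R_r ⊗_R B`;
* **`exists_isClosedImmersion_SpecMap_away_tensor_of_fiber`** — the geometric form: if the fibre of `Spec B → Spec R` at `𝔭`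
  (Mathlib `Scheme.Hom.fiberToSpecResidueField`) is a closed immersion then `Spec (R_r ⊗_R B) → Spec R_r` is a closed immersion for
  some `r ∉ 𝔭` (the base change of `Spec B → Spec R` to the basic open `D(r) = Spec R_r`).

Cell `hodgecm-mathlib`, F-DAG first hand (h2) «relative ampleness» (price sheet v0.1 §3 F-2a / §5 item 2), leaf (A-ii) of the
sockets 2026-08-30T02:07Z; count-neutral capital (HC_CM is proved only modulo the 7 printed citations until rung 0 closes).

## References
* A. Grothendieck, J. Dieudonné, *EGA III₁* (1961), Prop. 4.6.7 (ii); Thm. 4.7.1. [EGAIII1]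
* D. Mumford, *Abelian Varieties* (1970), §5, Cor. 2–3 (pp. 50–51) (Nakayama step). [MumfordAV1970]
* The Stacks Project, Tag 00DV (Nakayama's lemma), Tag 01QO/04XV (closed immersions). [StacksProject]
-/

universe u

open CategoryTheory AlgebraicGeometry TensorProduct

namespace Literature.AlgebraicGeometry.Morphisms

/-! ### Algebra: `B′ → B′ ⊗_R B` onto ⇔ the base change of `R → B` onto -/

section Algebra

variable {R B : Type u} [CommRing R] [CommRing B] [Algebra R B]

/-- For any `R`-algebra `B′`, the structure map `B′ → B′ ⊗_R B` is onto iff the base change `B′ ⊗_R R → B′ ⊗_R B` of the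
`R`-linear map `R → B` is onto (both have the same image, spanned by the `b′ ⊗ 1`). [cite: StacksProject, Tag 00DV] -/
theorem surjective_algebraMap_tensor_iff_surjective_baseChange (B' : Type u) [CommRing B'] [Algebra R B'] :
    Function.Surjective (algebraMap B' (B' ⊗[R] B)) ↔
      Function.Surjective ((Algebra.linearMap R B).baseChange B') := by
  have key : ∀ x : B' ⊗[R] R, (Algebra.linearMap R B).baseChange B' x =
      algebraMap B' (B' ⊗[R] B) (TensorProduct.rid R B' x) := by
    intro x
    induction x using TensorProduct.induction_on with
    | zero => simp
    | tmul b r =>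
      rw [LinearMap.baseChange_tmul, TensorProduct.rid_tmul, Algebra.linearMap_apply,
        Algebra.TensorProduct.algebraMap_apply, Algebra.algebraMap_self, RingHom.id_apply,
        Algebra.algebraMap_eq_smul_one, TensorProduct.tmul_smul, TensorProduct.smul_tmul']
    | add x y hx hy => rw [map_add, hx, hy, map_add, map_add]
  constructor
  · intro h t
    obtain ⟨b, rfl⟩ := h t
    exact ⟨(TensorProduct.rid R B').symm b, by rw [key, LinearEquiv.apply_symm_apply]⟩
  · intro h t
    obtain ⟨x, rfl⟩ := h t
    exact ⟨TensorProduct.rid R B' x, (key x).symm⟩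

/-- A closed immersion `Spec T → Spec K` has surjective ring map `K → T` (Mathlib: a closed immersion into an affine scheme is
`Spec` of a quotient / onto on global sections). [cite: StacksProject, Tag 01QO] -/
theorem surjective_of_isClosedImmersion_SpecMap {K T : CommRingCat.{u}} (φ : K ⟶ T) [IsClosedImmersion (Spec.map φ)] :
    Function.Surjective φ := by
  have h := (IsClosedImmersion.isAffine_surjective_of_isAffine (Spec.map φ)).2
  have hnat : (Spec.map φ).appTop ≫ (Scheme.ΓSpecIso T).hom = (Scheme.ΓSpecIso K).hom ≫ φ := Scheme.ΓSpecIso_naturality φ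
  have hφ : φ = (Scheme.ΓSpecIso K).inv ≫ (Spec.map φ).appTop ≫ (Scheme.ΓSpecIso T).hom := by
    rw [hnat, Iso.inv_hom_id_assoc]
  rw [hφ]
  change Function.Surjective (((Scheme.ΓSpecIso T).hom).hom ∘ ((Spec.map φ).appTop).hom ∘ ((Scheme.ΓSpecIso K).inv).hom)
  exact (ConcreteCategory.bijective_of_isIso (Scheme.ΓSpecIso T).hom).2.comp
    (h.comp (ConcreteCategory.bijective_of_isIso (Scheme.ΓSpecIso K).inv).2)

/-- **If `κ(𝔭) → κ(𝔭) ⊗_R B` is onto for a finite `R`-algebra `B`, then `R_r → R_r ⊗_R B` is onto for some `r ∉ 𝔭`**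
(Nakayama on `coker (R → B)`: ★ `Literature.Algebra.Module.exists_surjective_baseChange_away`).
[cite: MumfordAV1970, §5 Cor. 2 (p. 50)] [cite: StacksProject, Tag 00DV] -/
theorem exists_surjective_algebraMap_away_tensor_of_fiber [Module.Finite R B] (p : PrimeSpectrum R)
    (h : Function.Surjective (algebraMap p.asIdeal.ResidueField (p.asIdeal.ResidueField ⊗[R] B))) :
    ∃ r : R, r ∉ p.asIdeal ∧
      Function.Surjective (algebraMap (Localization.Away r) (Localization.Away r ⊗[R] B)) := by
  have h' := (surjective_algebraMap_tensor_iff_surjective_baseChange p.asIdeal.ResidueField).1 h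
  obtain ⟨r, hr, hsurj⟩ := Literature.Algebra.Module.exists_surjective_baseChange_away (Algebra.linearMap R B) p h'
  exact ⟨r, hr, (surjective_algebraMap_tensor_iff_surjective_baseChange (Localization.Away r)).2 hsurj⟩

end Algebra

/-! ### Geometry: the fibre is a closed immersion ⇒ closed immersion over a basic open -/

section Geometry

variable (R B : Type u) [CommRing R] [CommRing B] [Algebra R B]

/-- **A FINITE morphism `Spec B → Spec R` whose scheme-theoretic fibre at `𝔭` is a closed immersion (into `Spec κ(𝔭)`) is a
closed immersion over the basic open `D(r) = Spec R_r` for some `r ∉ 𝔭`**: the fibre is `Spec (κ(𝔭) ⊗_R B) → Spec κ(𝔭)`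
(Mathlib `Spec.fiberToSpecResidueFieldIso`), so `κ(𝔭) → κ(𝔭) ⊗_R B` is onto, whence `R_r → R_r ⊗_R B` is onto for some `r ∉ 𝔭`
(`exists_surjective_algebraMap_away_tensor_of_fiber`) and `Spec (R_r ⊗_R B) → Spec R_r` — the base change of `Spec B → Spec R`
to `D(r)` — is a closed immersion. Affine core of EGA III 4.6.7 (ii). [cite: EGAIII1, Prop. 4.6.7 (ii)]
[cite: MumfordAV1970, §5 Cor. 3 (p. 53)] -/
theorem exists_isClosedImmersion_SpecMap_away_tensor_of_fiber [Module.Finite R B] (p : PrimeSpectrum R)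
    (hp : IsClosedImmersion ((Spec.map (CommRingCat.ofHom (algebraMap R B))).fiberToSpecResidueField p)) :
    ∃ r : R, r ∉ p.asIdeal ∧
      IsClosedImmersion (Spec.map (CommRingCat.ofHom
        (algebraMap (Localization.Away r) (Localization.Away r ⊗[R] B)))) := by
  -- the fibre of `Spec B → Spec R` at `𝔭` is `Spec (κ(𝔭) ⊗ B) → Spec κ(𝔭)`
  have h1 : IsClosedImmersion (Spec.map (CommRingCat.ofHom
      (algebraMap p.asIdeal.ResidueField (p.asIdeal.Fiber B)))) :=
    (MorphismProperty.arrow_mk_iso_iff @IsClosedImmersion (Spec.fiberToSpecResidueFieldIso R B p)).mp hp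
  have h2 : Function.Surjective (algebraMap p.asIdeal.ResidueField (p.asIdeal.ResidueField ⊗[R] B)) :=
    surjective_of_isClosedImmersion_SpecMap (CommRingCat.ofHom (algebraMap p.asIdeal.ResidueField (p.asIdeal.Fiber B)))
  obtain ⟨r, hr, hsurj⟩ := exists_surjective_algebraMap_away_tensor_of_fiber p h2
  exact ⟨r, hr, IsClosedImmersion.spec_of_surjective _ hsurj⟩

end Geometry

end Literature.AlgebraicGeometry.Morphisms
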